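import Summits.Ventures.HodgeRepro2.T6A1HostBetti

/-!
# T6A1HostOrder — the RATIONAL identification `φ₁ : H1 K ≃ₗ[ℚ] H¹(B(ℂ), ℚ)` of the (S4) object, intertwining
the diagonal `K`-action with the order action (the seam with t6-p2's `OrderAction`, STATUS l. 10958 (3)(i))

From the Hodge-typed dictionary `factorIdentHC Bd C …` (`phi : H1C K ≃ₗ[ℂ] ℂ ⊗ H¹(B, ℚ)` with
`phi (h1ToC w) ∈ ratC`, `ratl1_iff`) the RATIONAL points: `phiQ : H1 K →ₗ[ℚ] HQ C.B.X 1` with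
`mk_one_phiQ : 1 ⊗ phiQ w = phi (h1ToC w)`, `phiQ_act : phiQ (actH1 K x v) = C.act x (phiQ v)` for EVERY
`x : K` (the `K`-equivariance of `phi` read on the rational points), `phiQ_bijective`, hence
**`phiQEquiv : H1 K ≃ₗ[ℚ] HQ C.B.X 1`** and, along `Bd.isoObj`, **`phiW : H1 K ≃ₗ[ℚ] Bd.W.obj C.B.X 1`** with
**`phiW_act_endo (x : C.O') : phiW (actH1 K x v) = Bd.W.pullback (avHom (C.endo x)) 1 (phiW v)`** —
exactly the `φ₁` / `φ₁_act` fields of t6-p2's `OrderAction W B K` at `endo x hx := avHom (C.endo ⟨x, hx⟩)`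
(v3's `act_endo` + `isoObj_pullback`). One `φ₁` for A1 and A2 (the lead's l. 5353 (4) / l. 10912 (2)(v)).
§8(d): uses an L-value-free non-vanishing device: NO.
-/

noncomputable section

open CategoryTheory
open scoped TensorProduct
open HostAPI.Carriers.AlgebraicGeometry.Motives HostAPI.Carriers.AlgebraicGeometry.HodgeTheory

namespace Summit.Ventures.HodgeRepro2.T6.A1HostOrder

open Host A1Dict A1DictRat A1DictHodge A1DictFactors A1BaseChange A1HostBetti

section order

variable {K : Type} [Field K] [NumberField K] [NumberField.IsCMField K] (Bd : BettiHodgeData ℂ)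
  (C : CornerProduct K)
  (hT : ∀ (i : Fin 4) (σ : K →+* ℂ), σ ∈ C.F.T i ↔ eigC (C.A i).act σ ≤ hodgeHC Bd (C.A i).smooth 1 1 0)
  (hcA : ∀ i, IsCompl (hodgeHC Bd (C.A i).smooth 1 1 0) (hodgeHC Bd (C.A i).smooth 1 0 1))
  (hcB : IsCompl (hodgeHC Bd C.smooth 1 1 0) (hodgeHC Bd C.smooth 1 0 1)) (h17 : Lemma1117Q)

omit [NumberField.IsCMField K] in
/-- `h1ToC` intertwines the diagonal actions `actH1` and `actH1C` (pointwise `1 ⊗ (x · w) = (1 ⊗ x)(1 ⊗ w)`). -/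
theorem h1ToC_actH1 (x : K) (w : H1 K) : h1ToC K (actH1 K x w) = A2Model.actH1C K x (h1ToC K w) := by
  funext i
  show (Algebra.TensorProduct.includeRight : K →ₐ[ℚ] ℂ ⊗[ℚ] K) (x * w i) =
    (Algebra.TensorProduct.includeRight : K →ₐ[ℚ] ℂ ⊗[ℚ] K) x *
      (Algebra.TensorProduct.includeRight : K →ₐ[ℚ] ℂ ⊗[ℚ] K) (w i)
  rw [map_mul]

/-- The `ℂ`-dictionary on a rational model class is a rational class of the host. -/
theorem phi_h1ToC_mem_ratC (w : H1 K) :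
    (factorIdentHC Bd C hT hcA hcB h17).phi C.F.deg6 (h1ToC K w) ∈ (ratC : Submodule ℚ (HC C.B.X 1)) :=
  (factorIdentHC Bd C hT hcA hcB h17).ratl1_phi_h1ToC C.F.deg6 w

/-- The rational classes of `ℂ ⊗ H¹(B, ℚ)` as a `ℚ`-space, identified with `H¹(B, ℚ)`. -/
abbrev ratEquiv : HQ C.B.X 1 ≃ₗ[ℚ] (ratC : Submodule ℚ (HC C.B.X 1)) :=
  LinearEquiv.ofInjective (TensorProduct.mk ℚ ℂ (HQ C.B.X 1) 1) mk_one_injective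

/-- THE RATIONAL DICTIONARY `phiQ : H1 K →ₗ[ℚ] H¹(B(ℂ), ℚ)`: `phi` on the rational model classes, read on the
rational points of `ℂ ⊗ H¹(B, ℚ)`. -/
def phiQ : H1 K →ₗ[ℚ] HQ C.B.X 1 :=
  (ratEquiv C).symm.toLinearMap ∘ₗ
    (LinearMap.codRestrict (ratC : Submodule ℚ (HC C.B.X 1))
      (((factorIdentHC Bd C hT hcA hcB h17).phi C.F.deg6).toLinearMap.restrictScalars ℚ ∘ₗ h1ToC K)
      (phi_h1ToC_mem_ratC Bd C hT hcA hcB h17))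

/-- `1 ⊗ phiQ w = phi (h1ToC w)`. -/
theorem mk_one_phiQ (w : H1 K) :
    (1 : ℂ) ⊗ₜ[ℚ] phiQ Bd C hT hcA hcB h17 w = (factorIdentHC Bd C hT hcA hcB h17).phi C.F.deg6 (h1ToC K w) := by
  have h1 : phiQ Bd C hT hcA hcB h17 w =
      (ratEquiv C).symm ⟨_, phi_h1ToC_mem_ratC Bd C hT hcA hcB h17 w⟩ := rfl
  rw [h1]
  calc (1 : ℂ) ⊗ₜ[ℚ] (ratEquiv C).symm ⟨_, phi_h1ToC_mem_ratC Bd C hT hcA hcB h17 w⟩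
      = ((ratEquiv C) ((ratEquiv C).symm ⟨_, phi_h1ToC_mem_ratC Bd C hT hcA hcB h17 w⟩) : HC C.B.X 1) := by
        rw [LinearEquiv.ofInjective_apply]
        rfl
    _ = (factorIdentHC Bd C hT hcA hcB h17).phi C.F.deg6 (h1ToC K w) := by
        rw [LinearEquiv.apply_symm_apply]

/-- `phiQ` IS `K`-EQUIVARIANT: `phiQ (actH1 K x v) = C.act x (phiQ v)` for every `x : K`. -/
theorem phiQ_act (x : K) (w : H1 K) :
    phiQ Bd C hT hcA hcB h17 (actH1 K x w) = C.act x (phiQ Bd C hT hcA hcB h17 w) := by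
  apply mk_one_injective
  show (1 : ℂ) ⊗ₜ[ℚ] phiQ Bd C hT hcA hcB h17 (actH1 K x w) = (1 : ℂ) ⊗ₜ[ℚ] C.act x (phiQ Bd C hT hcA hcB h17 w)
  rw [mk_one_phiQ, h1ToC_actH1, (factorIdentHC Bd C hT hcA hcB h17).phi_act C.F.deg6, ← mk_one_phiQ]
  exact bcAct_tmul C.act x 1 _

/-- `phiQ` is bijective (`phi` is injective; every rational class is `phi` of a rational model class). -/
theorem phiQ_bijective : Function.Bijective (phiQ Bd C hT hcA hcB h17) := by
  constructor
  · intro w w' h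
    have h1 : (factorIdentHC Bd C hT hcA hcB h17).phi C.F.deg6 (h1ToC K w) =
        (factorIdentHC Bd C hT hcA hcB h17).phi C.F.deg6 (h1ToC K w') := by
      rw [← mk_one_phiQ, ← mk_one_phiQ, h]
    have h2 := (factorIdentHC Bd C hT hcA hcB h17).phi C.F.deg6 |>.injective h1
    funext i
    have := congrFun h2 i
    exact Algebra.TensorProduct.includeRight_injective (Rat.cast_injective) this
  · intro q
    obtain ⟨w, hw⟩ := (factorIdentHC Bd C hT hcA hcB h17).exists_phi_h1ToC_eq C.F.deg6
      (r := (1 : ℂ) ⊗ₜ[ℚ] q) ⟨q, rfl⟩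
    exact ⟨w, mk_one_injective (by rw [TensorProduct.mk_apply, TensorProduct.mk_apply, mk_one_phiQ, hw])⟩

/-- THE RATIONAL DICTIONARY AS AN EQUIVALENCE `H1 K ≃ₗ[ℚ] H¹(B(ℂ), ℚ)`. -/
def phiQEquiv : H1 K ≃ₗ[ℚ] HQ C.B.X 1 :=
  LinearEquiv.ofBijective (phiQ Bd C hT hcA hcB h17) (phiQ_bijective Bd C hT hcA hcB h17)

/-- THE RATIONAL DICTIONARY ON THE WEIL CARRIER `φ₁ : H1 K ≃ₗ[ℚ] Bd.W.obj B.X 1` (t6-p2's `OrderAction.φ₁`). -/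
def phiW : H1 K ≃ₗ[ℚ] Bd.W.obj C.B.X 1 :=
  (phiQEquiv Bd C hT hcA hcB h17).trans (Bd.isoObj C.B.X 1).symm

/-- `phiW` intertwines the diagonal action with the order action on the Weil carrier (t6-p2's
`OrderAction.φ₁_act` at `endo x hx := avHom (C.endo ⟨x, hx⟩)`): `act_endo` + `isoObj_pullback`. -/
theorem phiW_act_endo (x : C.O') (w : H1 K) :
    phiW Bd C hT hcA hcB h17 (actH1 K x w) =
      Bd.W.pullback (avHom (C.endo x)) 1 (phiW Bd C hT hcA hcB h17 w) := by
  apply (Bd.isoObj C.B.X 1).injective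
  rw [Bd.isoObj_pullback]
  simp only [phiW, LinearEquiv.trans_apply, LinearEquiv.apply_symm_apply]
  show phiQ Bd C hT hcA hcB h17 (actH1 K x w) = pullQ (avHom (C.endo x)) 1 (phiQ Bd C hT hcA hcB h17 w)
  rw [phiQ_act, C.act_endo x]

end order

end Summit.Ventures.HodgeRepro2.T6.A1HostOrder

end
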